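import Mathlib
import Summits.NavierStokesRegularity.NavierStokesRegularity.Theorems.EulerZoomLiouvillePowerGaugeEulerLiouvilleCasimirHaulTravelTools
import Literature.Analysis.FluidPDE.ClassicalSolution
import Literature.Analysis.FluidPDE.AxisymmetricEuler
import Literature.Analysis.FluidPDE.VectorCalculus
import HarnessLib

/-!
# Crux `EulerZoomLiouville.PowerGaugeEulerLiouville` (stmt-NavierStokesRegularity-19832), width sub-line `casimir_haul` (ns-idea-11, REV3),
# stub H4a `stub_haulTravel` — part (b): THE TRAVEL INEQUALITY

Seat ns-sfl-p1 g10 (`--supports stmt-NavierStokesRegularity-19832 --as helper`).  The line `Cruxes/PowerGaugeEulerLiouville/Lines/casimir_haul.lean`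
(REV3, sha16 31279a74fac8e2c7) registers `Sig.stub_haulTravel`; this file proves it with the line's abbreviations (`IsSlabBoundedSwirlFree`,
`IsLedgerFlow`, `solidCyl b = {r < 2b ∧ |x₂| < b}`, `haulShell b = {x ∈ B(0,3b) ∧ b ≤ r}`) δ-UNFOLDED, so the skeleton fills the stub by
`theorem stub_haulTravel : Sig.stub_haulTravel := CasimirHaul.haulTravel`.
THE STATEMENT: there is `K > 0` such that for every scale `b ≥ 1`, every slab-bounded classical axisymmetric swirl-free member `u`, every ledger
flow `X` on `[t₁,t₀]` (`t₁ < t₀ < 0`) of a measurable blob `S ⊆ B̄(0, b/4)`, there is an axial weight `w` (`|w| ≤ 1`) with, for all `s₁ ∈ (t₁,t₀)`,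
`vol S ≤ vol(X_{s₁}S ∩ B(0,3b)) + (K/b)·(∫_{(t₁,t₀)} ‖∫_{X_sS ∩ solidCyl b} w(x₂) u₂(s,x) dx‖ ds + ∫_{(t₁,t₀)} ∫_{X_sS ∩ haulShell b} ‖u(s,x)‖ dx ds)`.
THE PROOF (pure flow calculus; no gauge, no `ρ`): with the product cut-off `ψ_b` of part (a) (`…CasimirHaulTravelTools`: `ψ_b = 1` on
`B̄(0,b/4) ⊇ S = X_{t₀}S`, `0 ≤ ψ_b ≤ 𝟙_{B(0,3b)}`), the FTC along each trajectory (clause 3 of `IsLedgerFlow`, `hasDerivWithinAt_productCutoff_comp`)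
gives `1 − ψ_b(X_{s₁}x) = ∫_{s₁}^{t₀} ∇ψ_b(X_s x)·u(s, X_s x) ds`; Fubini on `S × (s₁,t₀]` (integrand jointly continuous by clause 1, bounded by the slab
bound) gives `vol S − ∫_S ψ_b∘X_{s₁} = ∫_{s₁}^{t₀} Φ`, `Φ(s) = ∫_S ∇ψ_b(X_s x)·u(s,X_s x) dx`; per slice the CORE/SHELL SPLIT
`abs_productCutoffRate_sub_axial_le` and the flow's change of variables (clause 6, real form `setIntegral_image_eq_of_lintegral_comp`) give
`Φ(s) ≤ ((C_ζ+1)/b)|∫_{X_sS ∩ cyl} w u₂| + ((C_ζ+4C_χ)/b)∫_{X_sS ∩ shell}‖u‖`, `w = ζ′(·/b)/(C_ζ+1)`, `K = C_ζ + 1 + 4C_χ`; and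
`∫_S ψ_b∘X_{s₁} ≤ vol(X_{s₁}S ∩ B(0,3b))`.  ★ `haulTravel` — H4a, signature unfolded.
HONEST FRAMING: Lagrangian bookkeeping for a width sub-line of the crux class (the kill composes H4a with H4c and H3; H6 is the wall); nothing
here bears on the crux E (19832 OPEN) or on NS regularity; no summit statement is proved by this file; not E.
[cite: MajdaBertozziCUP2002, §1.3 Prop. 1.4 (transport along particle trajectories); Hartman2002, Ch. V Cor. 3.1]
-/

noncomputable section

-- flat `Theorems/<Route><Decl>…` files of one crux share the namespace of the crux (tree convention)
set_option linter.dupNamespace false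

open MeasureTheory Set Filter Topology Metric Function
open scoped NNReal ENNReal Topology

namespace Summit.NavierStokesRegularity.NavierStokesRegularity.Theorems.PowerGaugeEulerLiouville.CasimirHaul

open Literature.Analysis Literature.Analysis.FluidPDE

/-- ★ **H4a `stub_haulTravel` of the line `casimir_haul`, signature unfolded** (THE TRAVEL INEQUALITY; statement and proof sketch in the module
docstring).  Witness weight `w z = ζ′(z/b)/(C_ζ+1)`; constant `K = C_ζ + 1 + 4C_χ` from the two fixed bumps `ζ = ⟨½, 1⟩`, `χ = ⟨1, 4⟩`.
[cite: MajdaBertozziCUP2002, §1.3 Prop. 1.4] -/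
theorem haulTravel :
    ∃ K : ℝ, 0 < K ∧ ∀ b : ℝ, 1 ≤ b →
      ∀ (u : ℝ → EuclideanSpace ℝ (Fin 3) → EuclideanSpace ℝ (Fin 3)) (p : ℝ → EuclideanSpace ℝ (Fin 3) → ℝ),
        (IsClassicalEulerSolutionOn (Set.Iio 0) 0 u p ∧
            (∀ τ : ℝ, τ < 0 → IsAxisymmetric (u τ) ∧ HasNoSwirl (u τ)) ∧
            (∀ T₁ T₀ : ℝ, T₁ ≤ T₀ → T₀ < 0 → ∃ B : ℝ, ∀ τ ∈ Set.Icc T₁ T₀, ∀ x : EuclideanSpace ℝ (Fin 3), ‖u τ x‖ ≤ B)) →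
        ∀ lam t₁ t₀ : ℝ, t₁ < t₀ → t₀ < 0 →
          ∀ S : Set (EuclideanSpace ℝ (Fin 3)), MeasurableSet S →
            S ⊆ Metric.closedBall (0 : EuclideanSpace ℝ (Fin 3)) (b / 4) →
            ∀ X : ℝ → EuclideanSpace ℝ (Fin 3) → EuclideanSpace ℝ (Fin 3),
              (Continuous (fun q : ℝ × EuclideanSpace ℝ (Fin 3) => X q.1 q.2) ∧
                  (∀ x ∈ S, X t₀ x = x) ∧
                  (∀ s ∈ Set.Icc t₁ t₀, ∀ x ∈ S,
                    HasDerivWithinAt (fun σ : ℝ => X σ x) (u s (X s x)) (Set.Icc t₁ t₀) s) ∧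
                  (∀ s ∈ Set.Icc t₁ t₀, Set.InjOn (X s) S) ∧
                  (∀ s ∈ Set.Icc t₁ t₀, MeasurableSet (X s '' S) ∧ volume (X s '' S) = volume S) ∧
                  (∀ s ∈ Set.Icc t₁ t₀, ∀ g : EuclideanSpace ℝ (Fin 3) → ℝ≥0∞, Measurable g →
                    ∫⁻ x in X s '' S, g x = ∫⁻ x in S, g (X s x)) ∧
                  (∃ R : ℝ, ∀ s ∈ Set.Icc t₁ t₀, X s '' S ⊆ Metric.ball (0 : EuclideanSpace ℝ (Fin 3)) R) ∧
                  (∀ s ∈ Set.Icc t₁ t₀, ∀ x ∈ S, lam * cylRadius (X s x) ≤ ‖curl (u s) (X s x)‖)) →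
              ∃ w : ℝ → ℝ, Measurable w ∧ (∀ z : ℝ, |w z| ≤ 1) ∧
                ∀ s₁ ∈ Set.Ioo t₁ t₀,
                  volume S ≤ volume (X s₁ '' S ∩ Metric.ball (0 : EuclideanSpace ℝ (Fin 3)) (3 * b)) +
                    ENNReal.ofReal (K / b) *
                      ((∫⁻ s in Set.Ioo t₁ t₀,
                          ‖∫ x in X s '' S ∩ {x : EuclideanSpace ℝ (Fin 3) | cylRadius x < 2 * b ∧ |x 2| < b},
                              w (x 2) * (u s x) 2‖ₑ) +
                        ∫⁻ s in Set.Ioo t₁ t₀,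
                          ∫⁻ x in X s '' S ∩ {x : EuclideanSpace ℝ (Fin 3) |
                              x ∈ Metric.ball (0 : EuclideanSpace ℝ (Fin 3)) (3 * b) ∧ b ≤ cylRadius x}, ‖u s x‖ₑ) := by
  -- the two fixed bumps and their derivative bounds
  set ζ : ContDiffBump (0 : ℝ) := ⟨1 / 2, 1, by norm_num, by norm_num⟩ with hζdef
  set χ : ContDiffBump (0 : ℝ) := ⟨1, 4, by norm_num, by norm_num⟩ with hχdef
  have hζi : ζ.rIn = 1 / 2 := rfl
  have hζo : ζ.rOut = 1 := rfl
  have hχi : χ.rIn = 1 := rfl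
  have hχo : χ.rOut = 4 := rfl
  obtain ⟨Cζ, hCζ0, hCζ⟩ := exists_bound_deriv_bump ζ
  obtain ⟨Cχ, hCχ0, hCχ⟩ := exists_bound_deriv_bump χ
  have hζc : Continuous (ζ : ℝ → ℝ) := ζ.continuous
  have hχc : Continuous (χ : ℝ → ℝ) := χ.continuous
  have hζ'c : Continuous (deriv (ζ : ℝ → ℝ)) := (ζ.contDiff (n := 1)).continuous_deriv le_rfl
  have hχ'c : Continuous (deriv (χ : ℝ → ℝ)) := (χ.contDiff (n := 1)).continuous_deriv le_rfl
  refine ⟨Cζ + 1 + 4 * Cχ, by positivity, ?_⟩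
  intro b hb u p hstr lam t₁ t₀ ht ht₀ S hSm hSsub X hX
  obtain ⟨hcl, -, hslab⟩ := hstr
  obtain ⟨hXc, hX0, hXd, -, hXvol, hXcov, -, -⟩ := hX
  have hb0 : 0 < b := by linarith
  have hK1 : 0 < Cζ + 1 := by linarith
  obtain ⟨B, hB⟩ := hslab t₁ t₀ ht.le ht₀
  have hB0 : 0 ≤ B := (norm_nonneg _).trans (hB t₀ (right_mem_Icc.2 ht.le) 0)
  -- the axial weight
  refine ⟨fun z => deriv (ζ : ℝ → ℝ) (z / b) / (Cζ + 1), ?_, ?_, ?_⟩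
  · exact ((hζ'c.comp (continuous_id.div_const b)).div_const _).measurable
  · intro z
    rw [abs_div, abs_of_pos hK1, div_le_one hK1]
    linarith [hCζ (z / b)]
  intro s₁ hs₁
  beta_reduce
  have hs₁I : Icc s₁ t₀ ⊆ Icc t₁ t₀ := Icc_subset_Icc hs₁.1.le le_rfl
  have hIoc : Ioc s₁ t₀ ⊆ Icc t₁ t₀ := fun s hs => ⟨hs₁.1.le.trans hs.1.le, hs.2⟩
  have hIcc0 : Icc t₁ t₀ ⊆ Iio 0 := fun s hs => lt_of_le_of_lt hs.2 ht₀
  set ψ : EuclideanSpace ℝ (Fin 3) → ℝ := fun x => ζ (x 2 / b) * χ ((x 0 ^ 2 + x 1 ^ 2) / b ^ 2) with hψ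
  set G : EuclideanSpace ℝ (Fin 3) → EuclideanSpace ℝ (Fin 3) → ℝ := fun y v =>
    deriv ζ (y 2 / b) * (v 2 / b) * χ ((y 0 ^ 2 + y 1 ^ 2) / b ^ 2) +
      ζ (y 2 / b) * (deriv χ ((y 0 ^ 2 + y 1 ^ 2) / b ^ 2) * ((2 * y 0 * v 0 + 2 * y 1 * v 1) / b ^ 2)) with hG
  -- the clamped time and the clamped velocity (continuous on all of `ℝ × ℝ³`)
  set π : ℝ → ℝ := fun s => max t₁ (min s t₀) with hπ
  have hπc : Continuous π := continuous_const.max (continuous_id.min continuous_const)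
  have hπI : ∀ s, π s ∈ Icc t₁ t₀ := fun s => ⟨le_max_left _ _, max_le ht.le (min_le_right _ _)⟩
  have hπid : ∀ s ∈ Icc t₁ t₀, π s = s := fun s hs => by
    simp only [hπ]; rw [min_eq_left hs.2, max_eq_right hs.1]
  have hũc : Continuous fun q : ℝ × EuclideanSpace ℝ (Fin 3) => u (π q.1) q.2 := by
    have h2 : Continuous fun q : ℝ × EuclideanSpace ℝ (Fin 3) => ((π q.1, q.2) : ℝ × EuclideanSpace ℝ (Fin 3)) :=
      (hπc.comp continuous_fst).prodMk continuous_snd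
    exact hcl.smooth_velocity.continuousOn.comp_continuous h2 fun q => mk_mem_prod (hIcc0 (hπI q.1)) (mem_univ _)
  set D : ℝ → EuclideanSpace ℝ (Fin 3) → ℝ := fun s x => G (X s x) (u (π s) (X s x)) with hD
  have hGc : Continuous fun q : EuclideanSpace ℝ (Fin 3) × EuclideanSpace ℝ (Fin 3) => G q.1 q.2 := by
    simp only [hG]
    fun_prop
  have hXs : ∀ s, Continuous (X s) := fun s => hXc.comp (continuous_const.prodMk continuous_id)
  have hDc : Continuous fun q : ℝ × EuclideanSpace ℝ (Fin 3) => D q.1 q.2 := by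
    have h1 : Continuous fun q : ℝ × EuclideanSpace ℝ (Fin 3) => u (π q.1) (X q.1 q.2) :=
      hũc.comp (continuous_fst.prodMk hXc)
    exact hGc.comp (hXc.prodMk h1)
  set cyl : Set (EuclideanSpace ℝ (Fin 3)) := {x : EuclideanSpace ℝ (Fin 3) | cylRadius x < 2 * b ∧ |x 2| < b} with hcyl
  set shell : Set (EuclideanSpace ℝ (Fin 3)) :=
    {x : EuclideanSpace ℝ (Fin 3) | x ∈ Metric.ball (0 : EuclideanSpace ℝ (Fin 3)) (3 * b) ∧ b ≤ cylRadius x} with hshell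
  have hc2 : Continuous fun x : EuclideanSpace ℝ (Fin 3) => x 2 := by fun_prop
  have hcylm : MeasurableSet cyl :=
    (isOpen_lt continuous_cylRadius continuous_const).measurableSet.inter (isOpen_lt (continuous_abs.comp hc2) continuous_const).measurableSet
  have hshellm : MeasurableSet shell :=
    measurableSet_ball.inter (isClosed_le continuous_const continuous_cylRadius).measurableSet
  have hSfin : volume S < ⊤ := lt_of_le_of_lt (measure_mono hSsub) measure_closedBall_lt_top
  haveI : IsFiniteMeasure (volume.restrict S) := isFiniteMeasure_restrict.2 hSfin.ne
  have hFTC : ∀ x ∈ S, ∫ s in s₁..t₀, D s x = 1 - ψ (X s₁ x) := by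
    intro x hx
    have hder : ∀ σ ∈ Icc t₁ t₀, HasDerivWithinAt (fun σ => ψ (X σ x)) (G (X σ x) (u σ (X σ x))) (Icc t₁ t₀) σ := by
      intro σ hσ
      simpa only [hψ, hG] using hasDerivWithinAt_productCutoff_comp ζ χ b (hXd σ hσ x hx)
    have hcont : ContinuousOn (fun σ => ψ (X σ x)) (Icc s₁ t₀) := fun σ hσ =>
      ((hder σ (hs₁I hσ)).continuousWithinAt).mono hs₁I
    have hderiv : ∀ σ ∈ Ioo s₁ t₀, HasDerivAt (fun σ => ψ (X σ x)) (D σ x) σ := by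
      intro σ hσ
      have hσI : σ ∈ Icc t₁ t₀ := ⟨(hs₁.1.trans hσ.1).le, hσ.2.le⟩
      have h := (hder σ hσI).hasDerivAt (Icc_mem_nhds (hs₁.1.trans hσ.1) hσ.2)
      simp only [hD, hπid σ hσI]
      exact h
    have hint : IntervalIntegrable (fun σ => D σ x) volume s₁ t₀ :=
      (hDc.comp (continuous_id.prodMk continuous_const)).intervalIntegrable _ _
    rw [intervalIntegral.integral_eq_sub_of_hasDerivAt_of_le hs₁.2.le hcont hderiv hint, hX0 x hx]
    simp only [hψ]
    rw [productCutoff_eq_one_of_mem_closedBall ζ χ hζi hχi hb0 (hSsub hx)]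
  set M : ℝ := (2 * Cζ + 4 * Cχ) / b * B with hM
  have hDbd : ∀ s ∈ Icc t₁ t₀, ∀ x : EuclideanSpace ℝ (Fin 3), |D s x| ≤ M := by
    intro s hs x
    simp only [hD, hG, hπid s hs]
    refine (abs_productCutoffRate_le ζ χ hζo hχi hχo hCζ hCχ hb _ _).trans ?_
    exact mul_le_mul_of_nonneg_left (hB s hs _) (by positivity)
  have hprod : Integrable (uncurry fun (x : EuclideanSpace ℝ (Fin 3)) (s : ℝ) => D s x)
      ((volume.restrict S).prod (volume.restrict (Ioc s₁ t₀))) := by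
    rw [Measure.prod_restrict]
    have hmeas : AEStronglyMeasurable (uncurry fun (x : EuclideanSpace ℝ (Fin 3)) (s : ℝ) => D s x) (volume.prod volume) :=
      (hDc.comp (continuous_snd.prodMk continuous_fst)).aestronglyMeasurable
    refine Measure.integrableOn_of_bounded (M := M) ?_ hmeas ?_
    · rw [Measure.prod_prod]
      exact ENNReal.mul_lt_top hSfin measure_Ioc_lt_top |>.ne
    · refine (ae_restrict_iff' (hSm.prod measurableSet_Ioc)).2 (ae_of_all _ ?_)
      rintro ⟨x, s⟩ ⟨-, hs⟩
      simpa only [uncurry, Real.norm_eq_abs] using hDbd s (hIoc hs) x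
  have hswap : ∫ x in S, ∫ s in Ioc s₁ t₀, D s x = ∫ s in Ioc s₁ t₀, ∫ x in S, D s x :=
    integral_integral_swap hprod
  have hψXm : ∀ s, Measurable fun x => ψ (X s x) := fun s => by
    have : Continuous ψ := by simp only [hψ]; fun_prop
    exact (this.comp (hXs s)).measurable
  have hψint : Integrable (fun x => ψ (X s₁ x)) (volume.restrict S) := by
    refine Integrable.mono' (integrable_const (1 : ℝ)) (hψXm s₁).aestronglyMeasurable (ae_of_all _ fun x => ?_)
    rw [Real.norm_eq_abs, abs_of_nonneg (productCutoff_nonneg_le_one ζ χ b _).1]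
    exact (productCutoff_nonneg_le_one ζ χ b _).2
  have hLHS : ∫ x in S, ∫ s in Ioc s₁ t₀, D s x = (volume S).toReal - ∫ x in S, ψ (X s₁ x) := by
    have h1 : ∫ x in S, ∫ s in Ioc s₁ t₀, D s x = ∫ x in S, (1 - ψ (X s₁ x)) := by
      refine setIntegral_congr_fun hSm fun x hx => ?_
      rw [← intervalIntegral.integral_of_le hs₁.2.le, hFTC x hx]
    rw [h1, integral_sub (integrable_const _) hψint, setIntegral_const, smul_eq_mul, mul_one]
    rfl
  -- `∫_S ψ∘X_{s₁} ≤ vol(X_{s₁}S ∩ B(0,3b))`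
  have hs₁I' : s₁ ∈ Icc t₁ t₀ := ⟨hs₁.1.le, hs₁.2.le⟩
  have hψle : ∫ x in S, ψ (X s₁ x) ≤ (volume (X s₁ '' S ∩ ball (0 : EuclideanSpace ℝ (Fin 3)) (3 * b))).toReal := by
    have hind : ∀ x, ψ (X s₁ x) ≤ (ball (0 : EuclideanSpace ℝ (Fin 3)) (3 * b)).indicator (fun _ => (1 : ℝ)) (X s₁ x) :=
      fun x => productCutoff_le_indicator_ball ζ χ hζo hχo hb0 _
    have hpre : MeasurableSet ((X s₁) ⁻¹' ball (0 : EuclideanSpace ℝ (Fin 3)) (3 * b)) := (hXs s₁).measurable measurableSet_ball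
    have hint1 : Integrable (fun x => (ball (0 : EuclideanSpace ℝ (Fin 3)) (3 * b)).indicator (fun _ => (1 : ℝ)) (X s₁ x))
        (volume.restrict S) := by
      have : (fun x => (ball (0 : EuclideanSpace ℝ (Fin 3)) (3 * b)).indicator (fun _ => (1 : ℝ)) (X s₁ x)) =
          ((X s₁) ⁻¹' ball (0 : EuclideanSpace ℝ (Fin 3)) (3 * b)).indicator (fun _ => (1 : ℝ)) := by
        funext x; rfl
      rw [this]
      exact (integrable_const (1 : ℝ)).indicator hpre
    refine (integral_mono hψint hint1 hind).trans (le_of_eq ?_)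
    -- the indicator integral is the volume, by the flow's change of variables
    have hcov := hXcov s₁ hs₁I' ((ball (0 : EuclideanSpace ℝ (Fin 3)) (3 * b)).indicator fun _ => (1 : ℝ≥0∞))
      (measurable_const.indicator measurableSet_ball)
    rw [integral_eq_lintegral_of_nonneg_ae (ae_of_all _ fun x => indicator_nonneg (fun _ _ => zero_le_one) _)
      hint1.aestronglyMeasurable]
    congr 1
    have e1 : ∀ x, ENNReal.ofReal ((ball (0 : EuclideanSpace ℝ (Fin 3)) (3 * b)).indicator (fun _ => (1 : ℝ)) (X s₁ x)) =
        (ball (0 : EuclideanSpace ℝ (Fin 3)) (3 * b)).indicator (fun _ => (1 : ℝ≥0∞)) (X s₁ x) := fun x => by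
      by_cases h : X s₁ x ∈ ball (0 : EuclideanSpace ℝ (Fin 3)) (3 * b)
      · rw [indicator_of_mem h, indicator_of_mem h, ENNReal.ofReal_one]
      · rw [indicator_of_notMem h, indicator_of_notMem h, ENNReal.ofReal_zero]
    simp_rw [e1]
    rw [← hcov, lintegral_indicator measurableSet_ball, Measure.restrict_restrict measurableSet_ball, lintegral_const,
      Measure.restrict_apply_univ, one_mul, inter_comm]
  -- the shell traffic through the flow's change of variables
  have hL₂eq : ∀ s ∈ Icc t₁ t₀, ∫⁻ x in X s '' S ∩ shell, ‖u s x‖ₑ = ∫⁻ x in S, shell.indicator (fun y => ‖u s y‖ₑ) (X s x) := by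
    intro s hs
    have hus : Continuous (u s) := (hcl.contDiff_velocity (hIcc0 hs)).continuous
    rw [← hXcov s hs _ (hus.measurable.enorm.indicator hshellm), lintegral_indicator hshellm,
      Measure.restrict_restrict hshellm, inter_comm]
  have hslice : ∀ s ∈ Ioc s₁ t₀, ENNReal.ofReal (∫ x in S, D s x) ≤
      ENNReal.ofReal ((Cζ + 1 + 4 * Cχ) / b) *
        (‖∫ x in X s '' S ∩ cyl, deriv (ζ : ℝ → ℝ) (x 2 / b) / (Cζ + 1) * (u s x) 2‖ₑ + ∫⁻ x in X s '' S ∩ shell, ‖u s x‖ₑ) := by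
    intro s hs
    have hsI : s ∈ Icc t₁ t₀ := hIoc hs
    have hs0 : s < 0 := hIcc0 hsI
    have hus : Continuous (u s) := (hcl.contDiff_velocity (show s ∈ Set.Iio 0 from hs0)).continuous
    have hXSm : MeasurableSet (X s '' S) := (hXvol s hsI).1
    haveI : IsFiniteMeasure (volume.restrict (X s '' S)) := by
      refine isFiniteMeasure_restrict.2 ?_
      rw [(hXvol s hsI).2]; exact hSfin.ne
    set Fs : EuclideanSpace ℝ (Fin 3) → ℝ := fun y => deriv (ζ : ℝ → ℝ) (y 2 / b) * (u s y) 2 with hFs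
    have hFsc : Continuous Fs := by simp only [hFs]; fun_prop
    set A : EuclideanSpace ℝ (Fin 3) → ℝ := fun x => 1 / b * cyl.indicator Fs (X s x) with hA
    have hAm : Measurable A := ((hFsc.measurable.indicator hcylm).comp (hXs s).measurable).const_mul _
    have hDs : ∀ x, D s x = G (X s x) (u s (X s x)) := fun x => by simp only [hD, hπid s hsI]
    -- the pointwise split
    have hsplit : ∀ x, |D s x - A x| ≤ (Cζ + 4 * Cχ) / b * shell.indicator (fun y => ‖u s y‖) (X s x) := by
      intro x
      have h := abs_productCutoffRate_sub_axial_le ζ χ hζo hχi hχo hCζ hCχ hb (X s x) (u s (X s x))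
      rw [← hcyl, ← hshell] at h
      have e1 : cyl.indicator (fun x' : EuclideanSpace ℝ (Fin 3) => deriv (ζ : ℝ → ℝ) (x' 2 / b) * (u s (X s x)) 2) (X s x) =
          cyl.indicator Fs (X s x) := by
        by_cases hx : X s x ∈ cyl
        · simp only [indicator_of_mem hx, hFs]
        · simp only [indicator_of_notMem hx]
      have e2 : shell.indicator (fun _ : EuclideanSpace ℝ (Fin 3) => ‖u s (X s x)‖) (X s x) =
          shell.indicator (fun y => ‖u s y‖) (X s x) := by
        by_cases hx : X s x ∈ shell
        · simp only [indicator_of_mem hx]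
        · simp only [indicator_of_notMem hx]
      rw [e1, e2] at h
      have hAx : A x = 1 / b * cyl.indicator Fs (X s x) := rfl
      rw [hDs x, hAx]
      exact h
    have hAbd : ∀ x, |A x| ≤ 1 / b * (Cζ * B) := by
      intro x
      rw [hA, abs_mul, abs_of_pos (by positivity : (0 : ℝ) < 1 / b)]
      refine mul_le_mul_of_nonneg_left ?_ (by positivity)
      by_cases hx : X s x ∈ cyl
      · rw [indicator_of_mem hx, hFs, abs_mul]
        obtain ⟨h2, -⟩ := coord_bounds (u s (X s x))
        exact mul_le_mul (hCζ _) (h2.trans (hB s hsI _)) (abs_nonneg _) hCζ0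
      · rw [indicator_of_notMem hx, abs_zero]; positivity
    have hAint : Integrable A (volume.restrict S) :=
      Integrable.mono' (integrable_const _) hAm.aestronglyMeasurable (ae_of_all _ fun x => (Real.norm_eq_abs _).le.trans (hAbd x))
    have hDint : Integrable (fun x => D s x) (volume.restrict S) :=
      Integrable.mono' (integrable_const M) (hDc.comp (continuous_const.prodMk continuous_id)).aestronglyMeasurable
        (ae_of_all _ fun x => (Real.norm_eq_abs _).le.trans (hDbd s hsI x))
    have hTint : Integrable (fun x => D s x - A x) (volume.restrict S) := hDint.sub hAint
    -- the axial piece through the change of variables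
    have hIm : MeasurableSet (X s '' S ∩ cyl) := hXSm.inter hcylm
    have hAeq : ∫ x in S, A x = (Cζ + 1) / b * ∫ x in X s '' S ∩ cyl, deriv (ζ : ℝ → ℝ) (x 2 / b) / (Cζ + 1) * (u s x) 2 := by
      have hcov := setIntegral_image_eq_of_lintegral_comp (hXs s).measurable (hXcov s hsI)
        ((hFsc.measurable.indicator hcylm).aestronglyMeasurable (μ := volume.restrict (X s '' S)))
      simp only [hA]
      rw [integral_const_mul, ← hcov, setIntegral_indicator hcylm]
      have e : ∀ x, Fs x = (Cζ + 1) * (deriv (ζ : ℝ → ℝ) (x 2 / b) / (Cζ + 1) * (u s x) 2) := fun x => by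
        simp only [hFs]; field_simp [hK1.ne']
      rw [setIntegral_congr_fun hIm (fun x _ => e x), integral_const_mul]
      ring
    -- the shell piece
    have hTle : ∫ x in S, (D s x - A x) ≤ (Cζ + 4 * Cχ) / b * (∫⁻ x in X s '' S ∩ shell, ‖u s x‖ₑ).toReal := by
      have hshc : Measurable fun x => shell.indicator (fun y => ‖u s y‖) (X s x) :=
        (hus.norm.measurable.indicator hshellm).comp (hXs s).measurable
      have hshbd : ∀ x, |shell.indicator (fun y => ‖u s y‖) (X s x)| ≤ B := fun x => by
        by_cases hx : X s x ∈ shell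
        · rw [indicator_of_mem hx, abs_of_nonneg (norm_nonneg _)]; exact hB s hsI _
        · rw [indicator_of_notMem hx, abs_zero]; exact hB0
      have hshint : Integrable (fun x => shell.indicator (fun y => ‖u s y‖) (X s x)) (volume.restrict S) :=
        Integrable.mono' (integrable_const B) hshc.aestronglyMeasurable
          (ae_of_all _ fun x => (Real.norm_eq_abs _).le.trans (hshbd x))
      have h1 : ∫ x in S, (D s x - A x) ≤ ∫ x in S, (Cζ + 4 * Cχ) / b * shell.indicator (fun y => ‖u s y‖) (X s x) :=
        integral_mono hTint (hshint.const_mul _) fun x => (le_abs_self _).trans (hsplit x)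
      refine h1.trans (le_of_eq ?_)
      rw [integral_const_mul]
      congr 1
      rw [integral_eq_lintegral_of_nonneg_ae (ae_of_all _ fun x => indicator_nonneg (fun _ _ => norm_nonneg _) _)
        hshint.aestronglyMeasurable, hL₂eq s hsI]
      congr 1
      refine lintegral_congr fun x => ?_
      by_cases hx : X s x ∈ shell
      · rw [indicator_of_mem hx, indicator_of_mem hx, ofReal_norm]
      · rw [indicator_of_notMem hx, indicator_of_notMem hx, ENNReal.ofReal_zero]
    have hsum : ∫ x in S, D s x = (∫ x in S, A x) + ∫ x in S, (D s x - A x) := by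
      rw [← integral_add hAint hTint]
      exact integral_congr_ae (ae_of_all _ fun x => by simp only [add_sub_cancel])
    set I₁ : ℝ := ∫ x in X s '' S ∩ cyl, deriv (ζ : ℝ → ℝ) (x 2 / b) / (Cζ + 1) * (u s x) 2 with hI₁
    set L₂ : ℝ≥0∞ := ∫⁻ x in X s '' S ∩ shell, ‖u s x‖ₑ with hL₂
    have hreal : ∫ x in S, D s x ≤ (Cζ + 1 + 4 * Cχ) / b * (|I₁| + L₂.toReal) := by
      rw [hsum, hAeq]
      have h1 : (Cζ + 1) / b * I₁ ≤ (Cζ + 1 + 4 * Cχ) / b * |I₁| := by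
        calc (Cζ + 1) / b * I₁ ≤ (Cζ + 1) / b * |I₁| := mul_le_mul_of_nonneg_left (le_abs_self _) (by positivity)
          _ ≤ (Cζ + 1 + 4 * Cχ) / b * |I₁| :=
              mul_le_mul_of_nonneg_right (div_le_div_of_nonneg_right (by linarith) hb0.le) (abs_nonneg _)
      have h2 : (Cζ + 4 * Cχ) / b * L₂.toReal ≤ (Cζ + 1 + 4 * Cχ) / b * L₂.toReal :=
        mul_le_mul_of_nonneg_right (div_le_div_of_nonneg_right (by linarith) hb0.le) ENNReal.toReal_nonneg
      linarith [hTle]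
    calc ENNReal.ofReal (∫ x in S, D s x) ≤ ENNReal.ofReal ((Cζ + 1 + 4 * Cχ) / b * (|I₁| + L₂.toReal)) :=
          ENNReal.ofReal_le_ofReal hreal
      _ = ENNReal.ofReal ((Cζ + 1 + 4 * Cχ) / b) * (ENNReal.ofReal |I₁| + ENNReal.ofReal L₂.toReal) := by
          rw [ENNReal.ofReal_mul (by positivity), ENNReal.ofReal_add (abs_nonneg _) ENNReal.toReal_nonneg]
      _ ≤ ENNReal.ofReal ((Cζ + 1 + 4 * Cχ) / b) * (‖I₁‖ₑ + L₂) := by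
          gcongr
          · exact (Real.enorm_eq_ofReal_abs _).ge
          · exact ENNReal.ofReal_toReal_le
  -- the slice integral is integrable in time (Fubini) and dominated by its positive part
  set Φ : ℝ → ℝ := fun s => ∫ x in S, D s x with hΦ
  have hΦint : Integrable Φ (volume.restrict (Ioc s₁ t₀)) := by
    simpa only [hΦ, uncurry] using hprod.integral_prod_right
  have hvolI : volume (X s₁ '' S ∩ ball (0 : EuclideanSpace ℝ (Fin 3)) (3 * b)) ≠ ⊤ := by
    refine (lt_of_le_of_lt (measure_mono inter_subset_left) ?_).ne
    rw [(hXvol s₁ hs₁I').2]; exact hSfin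
  have hreal : (volume S).toReal ≤ (volume (X s₁ '' S ∩ ball (0 : EuclideanSpace ℝ (Fin 3)) (3 * b))).toReal +
      ∫ s in Ioc s₁ t₀, Φ s := by
    have := hLHS.symm.trans hswap
    linarith
  -- measurability in time of the shell traffic (clamped velocity, change of variables)
  have hL₂m : AEMeasurable (fun s => ∫⁻ x in X s '' S ∩ shell, ‖u s x‖ₑ) (volume.restrict (Ioo t₁ t₀)) := by
    have hf : Measurable fun q : ℝ × EuclideanSpace ℝ (Fin 3) => shell.indicator (fun y => ‖u (π q.1) y‖ₑ) (X q.1 q.2) := by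
      have h1 : Measurable fun q : ℝ × EuclideanSpace ℝ (Fin 3) => ‖u (π q.1) (X q.1 q.2)‖ₑ :=
        (hũc.comp (continuous_fst.prodMk hXc)).measurable.enorm
      have h2 : MeasurableSet ((fun q : ℝ × EuclideanSpace ℝ (Fin 3) => X q.1 q.2) ⁻¹' shell) := hXc.measurable hshellm
      have e : (fun q : ℝ × EuclideanSpace ℝ (Fin 3) => shell.indicator (fun y => ‖u (π q.1) y‖ₑ) (X q.1 q.2)) =
          ((fun q : ℝ × EuclideanSpace ℝ (Fin 3) => X q.1 q.2) ⁻¹' shell).indicator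
            (fun q => ‖u (π q.1) (X q.1 q.2)‖ₑ) := by
        funext q
        rfl
      rw [e]; exact h1.indicator h2
    have hm : Measurable fun s => ∫⁻ x in S, shell.indicator (fun y => ‖u (π s) y‖ₑ) (X s x) :=
      hf.lintegral_prod_right' (ν := volume.restrict S)
    refine (hm.aemeasurable.mono_measure Measure.restrict_le_self).congr ?_
    refine (ae_restrict_iff' measurableSet_Ioo).2 (ae_of_all _ fun s hs => ?_)
    have hsI : s ∈ Icc t₁ t₀ := ⟨hs.1.le, hs.2.le⟩
    simp only [hπid s hsI]
    exact (hL₂eq s hsI).symm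
  have hIocIoo : Ioc s₁ t₀ ≤ᵐ[volume] Ioo t₁ t₀ :=
    (Ioo_ae_eq_Ioc (μ := volume) (a := s₁) (b := t₀)).symm.le.trans
      ((show Ioo s₁ t₀ ≤ Ioo t₁ t₀ from Ioo_subset_Ioo hs₁.1.le le_rfl).eventuallyLE)
  have h4 : ENNReal.ofReal (∫ s in Ioc s₁ t₀, Φ s) ≤ ENNReal.ofReal ((Cζ + 1 + 4 * Cχ) / b) *
      ((∫⁻ s in Ioo t₁ t₀, ‖∫ x in X s '' S ∩ cyl, deriv (ζ : ℝ → ℝ) (x 2 / b) / (Cζ + 1) * (u s x) 2‖ₑ) +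
        ∫⁻ s in Ioo t₁ t₀, ∫⁻ x in X s '' S ∩ shell, ‖u s x‖ₑ) := by
    have hpos : ∫ s in Ioc s₁ t₀, Φ s ≤ ∫ s in Ioc s₁ t₀, max (Φ s) 0 :=
      integral_mono hΦint hΦint.pos_part fun s => le_max_left _ _
    have hmax : ∀ s, ENNReal.ofReal (max (Φ s) 0) = ENNReal.ofReal (Φ s) := fun s => by
      rcases le_total (Φ s) 0 with h | h
      · rw [max_eq_right h, ENNReal.ofReal_of_nonpos h, ENNReal.ofReal_zero]
      · rw [max_eq_left h]
    calc ENNReal.ofReal (∫ s in Ioc s₁ t₀, Φ s) ≤ ENNReal.ofReal (∫ s in Ioc s₁ t₀, max (Φ s) 0) := ENNReal.ofReal_le_ofReal hpos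
      _ = ∫⁻ s in Ioc s₁ t₀, ENNReal.ofReal (Φ s) := by
          rw [ofReal_integral_eq_lintegral_ofReal hΦint.pos_part (ae_of_all _ fun s => le_max_right _ _)]
          simp_rw [hmax]
      _ ≤ ∫⁻ s in Ioc s₁ t₀, ENNReal.ofReal ((Cζ + 1 + 4 * Cχ) / b) *
            (‖∫ x in X s '' S ∩ cyl, deriv (ζ : ℝ → ℝ) (x 2 / b) / (Cζ + 1) * (u s x) 2‖ₑ + ∫⁻ x in X s '' S ∩ shell, ‖u s x‖ₑ) :=
          lintegral_mono_ae ((ae_restrict_iff' measurableSet_Ioc).2 (ae_of_all _ fun s hs => hslice s hs))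
      _ = ENNReal.ofReal ((Cζ + 1 + 4 * Cχ) / b) * ∫⁻ s in Ioc s₁ t₀,
            (‖∫ x in X s '' S ∩ cyl, deriv (ζ : ℝ → ℝ) (x 2 / b) / (Cζ + 1) * (u s x) 2‖ₑ + ∫⁻ x in X s '' S ∩ shell, ‖u s x‖ₑ) :=
          lintegral_const_mul' _ _ ENNReal.ofReal_ne_top
      _ ≤ ENNReal.ofReal ((Cζ + 1 + 4 * Cχ) / b) * ∫⁻ s in Ioo t₁ t₀,
            (‖∫ x in X s '' S ∩ cyl, deriv (ζ : ℝ → ℝ) (x 2 / b) / (Cζ + 1) * (u s x) 2‖ₑ + ∫⁻ x in X s '' S ∩ shell, ‖u s x‖ₑ) :=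
          mul_le_mul' le_rfl (lintegral_mono_set' hIocIoo)
      _ = _ := by rw [lintegral_add_right' _ hL₂m]
  calc volume S = ENNReal.ofReal (volume S).toReal := (ENNReal.ofReal_toReal hSfin.ne).symm
    _ ≤ ENNReal.ofReal ((volume (X s₁ '' S ∩ ball (0 : EuclideanSpace ℝ (Fin 3)) (3 * b))).toReal + ∫ s in Ioc s₁ t₀, Φ s) :=
        ENNReal.ofReal_le_ofReal hreal
    _ ≤ ENNReal.ofReal (volume (X s₁ '' S ∩ ball (0 : EuclideanSpace ℝ (Fin 3)) (3 * b))).toReal +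
          ENNReal.ofReal (∫ s in Ioc s₁ t₀, Φ s) := ENNReal.ofReal_add_le
    _ = volume (X s₁ '' S ∩ ball (0 : EuclideanSpace ℝ (Fin 3)) (3 * b)) + ENNReal.ofReal (∫ s in Ioc s₁ t₀, Φ s) := by
        rw [ENNReal.ofReal_toReal hvolI]
    _ ≤ _ := add_le_add le_rfl h4

end Summit.NavierStokesRegularity.NavierStokesRegularity.Theorems.PowerGaugeEulerLiouville.CasimirHaul

end
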